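import Literature.NumberTheory.LFunctions.LocalRiemannHypothesis
import Literature.NumberTheory.LFunctions.LocalRiemannHypothesisStripLemma
import HarnessLib

/-!
# The local Riemann hypothesis: BCKV's second proof, end to end

`LocalRiemannHypothesis.lean` proves that the Hermite–Mellin polynomials `Q_K = hermiteMellinPoly δ K`
have all their zeros on `Re s = 1/2` by the Jacobi-matrix (Srednicki) route;
`LocalRiemannHypothesisStripLemma.lean` proves the BCKV strip lemma and its eigenfunction corollary
`bckv_roots_re_eq_zero_of_eigen`. This file supplies the missing link of the SECOND proof of
[cite: BumpEtAl2000, Thm 1] as printed [cite: BumpEtAl2000, §1, second proof of Thm. 1]: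
"Integrating the Schrödinger equation by parts gives `M(s+2) − (1/4π²)(s−1)(s−2)M(s−2) = (λ/2π)M(s)`
… we have therefore either `λp(s) = s·p(s+2) − (s−1)p(s−2)` or `λp(s) = (s+1)p(s+2) − (s−2)p(s−2)`
… with `q(s) = p(s+1/2)`: `λq(s) = (s+a)q(s+2) − (s−a)q(s−2)`, `a = 1/2` or `3/2`. The theorem now
follows from the Lemma."

In the normalisation of `LocalRiemannHypothesis.lean` (`ψ_n = He_n(x)e^{−x²/4}`, `n = 2K+δ`,
`δ ∈ {0,1}`, `Q_K = M[ψ_n]/M[ψ_δ]`) the Schrödinger equation `ψ_n'' = (x²/4 − n − 1/2)ψ_n` reads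
`(2n+1)·Q_K(s) = (s+δ)·Q_K(s+2) − (s−1−δ)·Q_K(s−2)` (`aeval_hermiteMellinPoly_schroedinger`). We
derive it purely algebraically from the three-term recursion of `Q_K`, via the two shift identities
`2(s+δ)Q_{M+1}(s+2) = Q_{M+2}(s) + (2n+1)Q_{M+1}(s) + n(n−1)Q_M(s)` (Mellin image of
`x²ψ_n = ψ_{n+2} + (2n+1)ψ_n + n(n−1)ψ_{n−2}`) and its `s ↦ s−2` companion, each proved by a
two-step induction (the base cases are exactly where `δ(δ−1) = 0`, i.e. `δ ∈ {0,1}`, is used).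
Then `q = Q_K(· + 1/2)` is an eigenfunction of `S(1/2+δ, 2, 1)` with eigenvalue `2n+1`
(`redmondOp_hermiteMellinPolyCentred`), and `hermiteMellinPoly_re_eq_half_of_stripLemma` is the
local Riemann hypothesis for the polynomial factor obtained by the strip-lemma route — a second,
independent kernel derivation of `LocalRH.hermiteMellinPoly_re_eq_half` (for `δ ∈ {0,1}`; the
Jacobi route there works for every `δ`). No named facts are introduced.
-/

noncomputable section

namespace Literature.NumberTheory.LFunctions

open Polynomial

namespace LocalRH

section SecondProof

open LocalRH

/-- Shorthand: the Hermite–Mellin polynomial `Q_K` of `LocalRiemannHypothesis.lean` evaluated at a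
complex point. [cite: BumpEtAl2000, §1, second proof of Thm. 1] -/
private noncomputable abbrev F (δ K : ℕ) (s : ℂ) : ℂ := aeval s (hermiteMellinPoly δ K)

/-- The `x²`-ladder in Mellin variables (shift `s ↦ s+2`): for `δ ∈ {0,1}` and `n = 2(M+1)+δ`,
`2(s+δ)·Q_{M+1}(s+2) = Q_{M+2}(s) + (2n+1)·Q_{M+1}(s) + n(n−1)·Q_M(s)` — the Mellin image of
`x²ψ_n = ψ_{n+2} + (2n+1)ψ_n + n(n−1)ψ_{n−2}` divided by `M[ψ_δ]`.
[cite: BumpEtAl2000, §1, second proof of Thm. 1] -/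
theorem aeval_hermiteMellinPoly_shift_two {δ : ℕ} (hδ : δ = 0 ∨ δ = 1) : ∀ (M : ℕ) (s : ℂ),
    2 * (s + δ) * F δ (M + 1) (s + 2) = F δ (M + 2) s
      + (2 * (2 * (M : ℂ) + 2 + δ) + 1) * F δ (M + 1) s
      + ((2 * (M : ℂ) + 2 + δ) * (2 * (M : ℂ) + 1 + δ)) * F δ M s
  | 0, s => by
    have e0 : ∀ t : ℂ, F δ 0 t = 1 := fun t => by simp [F]
    have e1 : ∀ t : ℂ, F δ 1 t = 2 * t - 1 := fun t => aeval_hermiteMellinPoly_one δ t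
    have e2 : ∀ t : ℂ, F δ 2 t = (2 * t - 1) * F δ 1 t
        + (((2 * 0 + 2 + δ) * (2 * 0 + 1 + δ) : ℕ) : ℂ) * F δ 0 t :=
      fun t => aeval_hermiteMellinPoly_add_two δ 0 t
    simp only [Nat.reduceAdd]
    simp only [e2, e1, e0]
    push_cast
    rcases hδ with rfl | rfl <;> push_cast <;> ring
  | 1, s => by
    have e0 : ∀ t : ℂ, F δ 0 t = 1 := fun t => by simp [F]
    have e1 : ∀ t : ℂ, F δ 1 t = 2 * t - 1 := fun t => aeval_hermiteMellinPoly_one δ t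
    have e2 : ∀ t : ℂ, F δ 2 t = (2 * t - 1) * F δ 1 t
        + (((2 * 0 + 2 + δ) * (2 * 0 + 1 + δ) : ℕ) : ℂ) * F δ 0 t :=
      fun t => aeval_hermiteMellinPoly_add_two δ 0 t
    have e3 : ∀ t : ℂ, F δ 3 t = (2 * t - 1) * F δ 2 t
        + (((2 * 1 + 2 + δ) * (2 * 1 + 1 + δ) : ℕ) : ℂ) * F δ 1 t :=
      fun t => aeval_hermiteMellinPoly_add_two δ 1 t
    simp only [Nat.reduceAdd]
    simp only [e3, e2, e1, e0]
    push_cast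
    rcases hδ with rfl | rfl <;> push_cast <;> ring
  | (M + 2), s => by
    have h1 := aeval_hermiteMellinPoly_add_two δ (M + 1) (s + 2)
    have h2 := aeval_hermiteMellinPoly_shift_two hδ (M + 1) s
    have h3 := aeval_hermiteMellinPoly_shift_two hδ M s
    have h4 := aeval_hermiteMellinPoly_add_two δ (M + 2) s
    have h5 := aeval_hermiteMellinPoly_add_two δ (M + 1) s
    have h6 := aeval_hermiteMellinPoly_add_two δ M s
    simp only [F] at *
    push_cast at *
    linear_combination (2 * (s + δ)) * h1 + (2 * s + 3) * h2
      + ((2 * (M : ℂ) + 4 + δ) * (2 * (M : ℂ) + 3 + δ)) * h3 - h4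
      - (2 * (2 * (M : ℂ) + 4 + δ) + 1) * h5
      - ((2 * (M : ℂ) + 4 + δ) * (2 * (M : ℂ) + 3 + δ)) * h6

/-- The second-derivative ladder in Mellin variables (shift `s ↦ s−2`): for `δ ∈ {0,1}` and
`n = 2(M+1)+δ`, `2(s−1−δ)·Q_{M+1}(s−2) = Q_{M+2}(s) − (2n+1)·Q_{M+1}(s) + n(n−1)·Q_M(s)`.
[cite: BumpEtAl2000, §1, second proof of Thm. 1] -/
theorem aeval_hermiteMellinPoly_shift_neg_two {δ : ℕ} (hδ : δ = 0 ∨ δ = 1) : ∀ (M : ℕ) (s : ℂ),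
    2 * (s - 1 - δ) * F δ (M + 1) (s - 2) = F δ (M + 2) s
      - (2 * (2 * (M : ℂ) + 2 + δ) + 1) * F δ (M + 1) s
      + ((2 * (M : ℂ) + 2 + δ) * (2 * (M : ℂ) + 1 + δ)) * F δ M s
  | 0, s => by
    have e0 : ∀ t : ℂ, F δ 0 t = 1 := fun t => by simp [F]
    have e1 : ∀ t : ℂ, F δ 1 t = 2 * t - 1 := fun t => aeval_hermiteMellinPoly_one δ t
    have e2 : ∀ t : ℂ, F δ 2 t = (2 * t - 1) * F δ 1 t
        + (((2 * 0 + 2 + δ) * (2 * 0 + 1 + δ) : ℕ) : ℂ) * F δ 0 t :=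
      fun t => aeval_hermiteMellinPoly_add_two δ 0 t
    simp only [Nat.reduceAdd]
    simp only [e2, e1, e0]
    push_cast
    rcases hδ with rfl | rfl <;> push_cast <;> ring
  | 1, s => by
    have e0 : ∀ t : ℂ, F δ 0 t = 1 := fun t => by simp [F]
    have e1 : ∀ t : ℂ, F δ 1 t = 2 * t - 1 := fun t => aeval_hermiteMellinPoly_one δ t
    have e2 : ∀ t : ℂ, F δ 2 t = (2 * t - 1) * F δ 1 t
        + (((2 * 0 + 2 + δ) * (2 * 0 + 1 + δ) : ℕ) : ℂ) * F δ 0 t :=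
      fun t => aeval_hermiteMellinPoly_add_two δ 0 t
    have e3 : ∀ t : ℂ, F δ 3 t = (2 * t - 1) * F δ 2 t
        + (((2 * 1 + 2 + δ) * (2 * 1 + 1 + δ) : ℕ) : ℂ) * F δ 1 t :=
      fun t => aeval_hermiteMellinPoly_add_two δ 1 t
    simp only [Nat.reduceAdd]
    simp only [e3, e2, e1, e0]
    push_cast
    rcases hδ with rfl | rfl <;> push_cast <;> ring
  | (M + 2), s => by
    have h1 := aeval_hermiteMellinPoly_add_two δ (M + 1) (s - 2)
    have h2 := aeval_hermiteMellinPoly_shift_neg_two hδ (M + 1) s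
    have h3 := aeval_hermiteMellinPoly_shift_neg_two hδ M s
    have h4 := aeval_hermiteMellinPoly_add_two δ (M + 2) s
    have h5 := aeval_hermiteMellinPoly_add_two δ (M + 1) s
    have h6 := aeval_hermiteMellinPoly_add_two δ M s
    simp only [F] at *
    push_cast at *
    linear_combination (2 * (s - 1 - δ)) * h1 + (2 * s - 5) * h2
      + ((2 * (M : ℂ) + 4 + δ) * (2 * (M : ℂ) + 3 + δ)) * h3 - h4
      + (2 * (2 * (M : ℂ) + 4 + δ) + 1) * h5
      - ((2 * (M : ℂ) + 4 + δ) * (2 * (M : ℂ) + 3 + δ)) * h6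

/-- **The Mellin image of the Schrödinger equation** [cite: BumpEtAl2000, §1, second proof of
Thm. 1]: for `δ ∈ {0,1}`, `n = 2K+δ`, the Hermite–Mellin polynomial satisfies
`(2n+1)·Q_K(s) = (s+δ)·Q_K(s+2) − (s−1−δ)·Q_K(s−2)` — BCKV's `λp(s) = s·p(s+2) − (s−1)p(s−2)`
(`n` even) resp. `λp(s) = (s+1)p(s+2) − (s−2)p(s−2)` (`n` odd), with `λ = 2n+1` in the
normalisation `ψ_n = He_n e^{−x²/4}` of `LocalRiemannHypothesis.lean`. -/
theorem aeval_hermiteMellinPoly_schroedinger {δ : ℕ} (hδ : δ = 0 ∨ δ = 1) (K : ℕ) (s : ℂ) :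
    (2 * (2 * (K : ℂ) + δ) + 1) * aeval s (hermiteMellinPoly δ K) =
      (s + δ) * aeval (s + 2) (hermiteMellinPoly δ K)
        - (s - 1 - δ) * aeval (s - 2) (hermiteMellinPoly δ K) := by
  cases K with
  | zero => simp; ring
  | succ M =>
    have h1 := aeval_hermiteMellinPoly_shift_two hδ M s
    have h2 := aeval_hermiteMellinPoly_shift_neg_two hδ M s
    simp only [F] at h1 h2
    push_cast
    linear_combination (-(1 / 2 : ℂ)) * h1 + (1 / 2 : ℂ) * h2

/-- The centred polynomial `q(s) = Q_K(s + 1/2)` ("the situation will be more symmetrical if we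
make the substitution `q(s) = p(s + 1/2)`"). [cite: BumpEtAl2000, §1, second proof of Thm. 1] -/
noncomputable def hermiteMellinPolyCentred (δ K : ℕ) : ℂ[X] :=
  ((hermiteMellinPoly δ K).map (Int.castRingHom ℂ)).comp (X + C (1 / 2 : ℂ))

/-- `q(s) = Q_K(s + 1/2)`, evaluated. [cite: BumpEtAl2000, §1, second proof of Thm. 1] -/
theorem eval_hermiteMellinPolyCentred (δ K : ℕ) (s : ℂ) :
    (hermiteMellinPolyCentred δ K).eval s = aeval (s + 1 / 2) (hermiteMellinPoly δ K) := by
  rw [hermiteMellinPolyCentred, eval_comp, eval_map, ← algebraMap_int_eq, ← aeval_def]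
  simp

/-- `q ≠ 0`. [cite: BumpEtAl2000, §1, second proof of Thm. 1] -/
theorem hermiteMellinPolyCentred_ne_zero (δ K : ℕ) : hermiteMellinPolyCentred δ K ≠ 0 := by
  rw [hermiteMellinPolyCentred, Ne, comp_X_add_C_eq_zero_iff]
  exact map_hermiteMellinPoly_ne_zero δ K

/-- **`q` is an eigenfunction of BCKV's operator**: `S(1/2+δ, 2, 1) q = (2n+1)·q`, i.e.
`λq(s) = (s+a)q(s+2) − (s−a)q(s−2)` with `a = 1/2` (`n` even) or `a = 3/2` (`n` odd), `λ = 2n+1`,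
`n = 2K+δ`. [cite: BumpEtAl2000, §1, second proof of Thm. 1] -/
theorem redmondOp_hermiteMellinPolyCentred {δ : ℕ} (hδ : δ = 0 ∨ δ = 1) (K : ℕ) :
    redmondOp (((1 / 2 + δ : ℝ)) : ℂ) 2 1 (hermiteMellinPolyCentred δ K) =
      (2 * (2 * (K : ℂ) + δ) + 1) • hermiteMellinPolyCentred δ K := by
  apply Polynomial.funext
  intro s
  rw [eval_redmondOp, eval_smul, eval_hermiteMellinPolyCentred, eval_hermiteMellinPolyCentred,
    eval_hermiteMellinPolyCentred, smul_eq_mul]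
  have h := aeval_hermiteMellinPoly_schroedinger hδ K (s + 1 / 2)
  push_cast
  rw [h]
  ring_nf

/-- **Local Riemann hypothesis, BCKV's second proof, end to end**: for `δ ∈ {0,1}` every zero of
the Hermite–Mellin polynomial `Q_K` lies on `Re s = 1/2` — obtained here from the strip lemma
(`bckv_roots_re_eq_zero_of_eigen`) and the eigen-relation above, independently of the Jacobi-matrix
route `LocalRH.hermiteMellinPoly_re_eq_half`. [cite: BumpEtAl2000, §1, second proof of Thm. 1] -/
theorem hermiteMellinPoly_re_eq_half_of_stripLemma {δ : ℕ} (hδ : δ = 0 ∨ δ = 1) (K : ℕ) {s : ℂ}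
    (hs : aeval s (hermiteMellinPoly δ K) = 0) : s.re = 1 / 2 := by
  have ha : (0 : ℝ) < 1 / 2 + δ := by positivity
  have hroots := bckv_roots_re_eq_zero_of_eigen ha (hermiteMellinPolyCentred_ne_zero δ K)
    (μ := 2 * (2 * (K : ℂ) + δ) + 1) (redmondOp_hermiteMellinPolyCentred hδ K)
  have hmem : s - 1 / 2 ∈ (hermiteMellinPolyCentred δ K).roots := by
    rw [mem_roots (hermiteMellinPolyCentred_ne_zero δ K), IsRoot.def, eval_hermiteMellinPolyCentred]
    simpa using hs
  have := hroots _ hmem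
  simp at this
  linarith

end SecondProof

end LocalRH

end Literature.NumberTheory.LFunctions
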